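import Summits.ABC.ABC.Theorems.PlacewiseSzpiroSingleTowerSzpiroStubPotentiallyGoodOrdTwo
import Summits.ABC.ABC.Theorems.PlacewiseSzpiroSingleTowerSzpiroStubPotentiallyGoodTowerOdd
import Summits.ABC.ABC.Theorems.PlacewiseSzpiroSingleTowerSzpiroStubTwistTransferOdd
import Summits.ABC.ABC.Theorems.PlacewiseSzpiroSingleTowerSzpiroStubTwistTransferTwo
import Literature.NumberTheory.EllipticCurves.NeronLocalHeightCompletion
import Literature.NumberTheory.DiophantineGeometry.MinimalDiscriminantFactorizationProofs
import Literature.NumberTheory.DiophantineGeometry.ConductorFactorizationProofs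
import Literature.NumberTheory.DiophantineGeometry.ConductorRadicalProofs
import HarnessLib

/-!
# Route PlaceCountSzpiro — dictionary lemma «DiscLeJHeight» (helper for crux stmt-ABC-25422)

The level-1 split of the line (route file, TWO-LAYER PLAN; critic idea-crit-6 on LINE 15) factors X1
`PlaceBudgetSzpiro` as `JHeightPlaceBudget` (a place budget for the height of `j(E)`: load-bearing, OPEN,
NOT attempted here) + `DiscLeJHeight` (`Δ_min` is bounded by the height of `j` up to a fixed power of the
conductor: Tate's algorithm bookkeeping). This file proves the dictionary half with explicit constants:
`minimalDiscriminantNorm_dvd_den_j_mul` — **`|Δ_min(E)| ∣ 2⁸ · den(j_E) · N_E⁵`** for every `E/ℚ`;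
`log_minimalDiscriminantNorm_le_log_den_j` / `discLeJHeight` — `log |Δ_min| ≤ h(j) + 5 log N + 8 log 2`
(`h(j) = log den j`, resp. the route's `log max(|num j|, den j)`); `log_minimalDiscriminantNorm_le_budget_of_jHeight_le`
— per curve, `h(j) ≤ c^{ω(N)} (K log N + B)` (`c ≥ 1`) gives `log|Δ_min| ≤ c^{ω(N)} ((K+5) log N + (B + 8 log 2))`,
i.e. `JHeightPlaceBudget (c,K,B) ⟹ PlaceBudgetSzpiro (c, K+5, B + 8 log 2)` (the skeleton's `PlaceBudgetSzpiro_of`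
with the dictionary stub discharged; stated unfolded, so no registered decl is concluded under a hypothesis).

Proof, place by place (`DiscLeJHeight.localBound`: **`e_v ≤ δ_v + 5 f_v + 8·[p = 2]`** with `e_v = ord_v Δ_min`,
`δ_v = ord_p den(j) ≥ max(0, −ord_p j)`): good: `e_v = 0`; multiplicative: `|j|_v = exp(e_v)`
(`valuation_j_eq_exp_ordMinimalDiscriminant_of_hasMultiplicativeReductionAt`, `valuation_eq_exp_neg_padicValRat`);
additive with `j` integral: `m_v ≤ 9` components and Ogg's formula give `e_v ≤ f_v + 8 ≤ 5 f_v` at odd `p`,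
`e_v ≤ 18` at `p = 2` (tree Tate-algorithm lemmas of `SingleTowerSzpiroLine`); additive with `ord_p j < 0`: at odd
`p` the twist by `p*` is multiplicative with the same `j` and `e_v ≤ e_v(E ⊗ χ_{p*}) + 6 = δ_v + 6`
(`conductorExponent_twistModel_pstar_eq_one`, `ordMinimalDiscriminant_le_twist_add_six`); at `p = 2`,
`E ≅ T^{(d)}` (Tate normal form, `4 ∤ d`) has `(f, e) = (4, ν+12)` or `(6, ν+18)`, `ν = −ord_2 j ≤ δ_v`
(`kodairaSymbolAt_and_ordMinimalDiscriminant_of_emod_four_eq_three/two`). Summing exponents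
(`factorization_minimalDiscriminantNorm_holds`, `factorization_conductorNorm_holds`) gives the divisibility.

HONESTY (D-0139/D-0140). A dictionary lemma (Silverman AEC VII.5.1, VIII.8; ATAEC IV.9.4, Table 4.1,
IV.10–IV.11) at abc distance 0: NOT X1 (`PlaceBudgetSzpiro`, OPEN, 0 seats — all difficulty sits in the
`j`-height budget), NOT A-PS («NOT abc — POLY-SZPIRO(E)»), NOT abc; typed ≠ proved beyond the statements
below. No `sorry`, no new axiom, no `def`.
-/

noncomputable section

-- `Summit.<Summit>.<Problem>` is the mandated summit-side namespace (CONVENTIONS §2); for the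
-- single-conjunct summit `ABC` the two coincide, so the duplicate `ABC.ABC` is deliberate.
set_option linter.dupNamespace false

namespace Summit.ABC.ABC.Theorems

open scoped NumberField
open IsDedekindDomain Rat.HeightOneSpectrum Literature.NumberTheory.EllipticCurves
open Summit.ABC.ABC.Theorems.SingleTowerSzpiroLine
open Literature.NumberTheory.DiophantineGeometry Literature.NumberTheory.DiophantineGeometry.TateAlgorithm

namespace DiscLeJHeight

/-! ### Valuations and the denominator of a rational number -/

/-- `−ord_p q ≤ ord_p den(q)` for every rational `q` (`ord_p q = ord_p num(q) − ord_p den(q)`). [folklore] -/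
theorem neg_padicValRat_le_padicValNat_den (p : ℕ) (q : ℚ) :
    -padicValRat p q ≤ (padicValNat p q.den : ℤ) := by
  simp only [padicValRat]
  omega

/-- At a place `v` of `ℤ` over `p`: if `|q|_v = exp(n)` then `n ≤ ord_p den(q)` (`|q|_v = exp(−ord_p q)`). [folklore] -/
theorem le_factorization_den_of_valuation_eq (v : HeightOneSpectrum ℤ) {q : ℚ} {n : ℤ}
    (h : v.valuation ℚ q = WithZero.exp n) :
    n ≤ (q.den.factorization (natGenerator v) : ℤ) := by
  have hq : q ≠ 0 := by
    rintro rfl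
    rw [map_zero] at h
    exact WithZero.coe_ne_zero h.symm
  rw [Rat.HeightOneSpectrum.valuation_eq_exp_neg_padicValRat v hq] at h
  have hn : -padicValRat (natGenerator v) q = n := WithZero.exp_injective h
  rw [Nat.factorization_def _ (prime_natGenerator v), ← hn]
  exact neg_padicValRat_le_padicValNat_den _ _

/-- `v(x) = exp(−ord_p x)` for `x ≠ 0` at a place `v` of `𝓞 ℚ` over `p` (twin of the tree's `ℤ`-place lemma
`Rat.HeightOneSpectrum.valuation_eq_exp_neg_padicValRat`; Mathlib `valuation_equiv_padicValuation`, both send `p` to `exp(−1)`). [folklore] -/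
theorem valuation_ringOfIntegers_eq_exp_neg_padicValRat (v : HeightOneSpectrum (𝓞 ℚ)) {x : ℚ}
    (hx : x ≠ 0) : v.valuation ℚ x = WithZero.exp (-padicValRat (natGenerator v) x) := by
  haveI hp : Fact (natGenerator v).Prime := ⟨prime_natGenerator v⟩
  haveI hp' : Fact (Nat.Prime ((primesEquiv v : Nat.Primes) : ℕ)) := ⟨(primesEquiv v).2⟩
  have hequiv := valuation_equiv_padicValuation v
  set n : ℤ := padicValRat (natGenerator v) x with hn
  have h2x : Rat.padicValuation (primesEquiv v) x = WithZero.exp (-n) := by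
    change Rat.padicValuation (natGenerator v) x = _
    simp [Rat.padicValuation, hx, hn]
  have h2p : Rat.padicValuation (primesEquiv v) ((natGenerator v : ℚ) ^ n) = WithZero.exp (-n) := by
    change Rat.padicValuation (natGenerator v) _ = _
    rw [map_zpow₀, Rat.padicValuation_self, ← WithZero.exp_zsmul]
    simp
  have h1p : v.valuation ℚ ((natGenerator v : ℚ) ^ n) = WithZero.exp (-n) := by
    rw [map_zpow₀, Literature.NumberTheory.GaloisRepresentations.Rat.valuation_natGenerator,
      ← WithZero.exp_zsmul]
    simp
  rw [← h1p]
  exact (hequiv.eq_iff).mpr (h2x.trans h2p.symm)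

/-- At a place `v` of `𝓞 ℚ` over `p`: if `|q|_v = exp(n)` then `n ≤ ord_p den(q)`. [folklore] -/
theorem le_factorization_den_of_valuation_ringOfIntegers_eq (v : HeightOneSpectrum (𝓞 ℚ)) {q : ℚ}
    {n : ℤ} (h : v.valuation ℚ q = WithZero.exp n) :
    n ≤ (q.den.factorization (natGenerator v) : ℤ) := by
  have hq : q ≠ 0 := by
    rintro rfl
    rw [map_zero] at h
    exact WithZero.coe_ne_zero h.symm
  rw [valuation_ringOfIntegers_eq_exp_neg_padicValRat v hq] at h
  have hn : -padicValRat (natGenerator v) q = n := WithZero.exp_injective h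
  rw [Nat.factorization_def _ (prime_natGenerator v), ← hn]
  exact neg_padicValRat_le_padicValNat_den _ _

/-- `j` is a function of the curve (transport of the `IsElliptic` instance along an equality). [folklore] -/
theorem j_eq_of_eq {X Y : WeierstrassCurve ℚ} [hX : X.IsElliptic] [hY : Y.IsElliptic] (h : X = Y) :
    X.j = Y.j := by
  subst h
  rfl

/-! ### The local inequality, case by case -/

variable (W : WeierstrassCurve ℚ) [W.IsElliptic] (v : HeightOneSpectrum ℤ)

/-- **Multiplicative place: the tower is the pole of `j`.** `ord_v(Δ_min) ≤ ord_p den(j)` (in fact `=`):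
`|j|_v = exp(ord_v Δ_min)` (Silverman AEC VII.5.1(b)). [cite: SilvermanAEC2009, Prop. VII.5.1(b)] -/
theorem ordMinimalDiscriminant_le_den_of_hasMultiplicativeReductionAt
    (hm : W.HasMultiplicativeReductionAt v) :
    W.ordMinimalDiscriminant v ≤ (W.j).den.factorization (natGenerator v) := by
  have h := WeierstrassCurve.valuation_j_eq_exp_ordMinimalDiscriminant_of_hasMultiplicativeReductionAt
    v W hm
  have := le_factorization_den_of_valuation_eq v h
  omega

/-- At a bad place that is not multiplicative, `f_v ≥ 2`. [folklore] -/
theorem two_le_conductorExponent_of_not_hasMultiplicativeReductionAt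
    (h0 : W.ordMinimalDiscriminant v ≠ 0) (hm : ¬ W.HasMultiplicativeReductionAt v) :
    2 ≤ W.conductorExponent v := by
  have hf0 : W.conductorExponent v ≠ 0 :=
    (WeierstrassCurve.conductorExponent_ne_zero_iff_ordMinimalDiscriminant_ne_zero v W).mpr h0
  have hf1 : W.conductorExponent v ≠ 1 := fun h1 =>
    hm ((WeierstrassCurve.conductorExponent_eq_one_iff_holds v W).mp h1)
  omega

/-- **Potentially good, odd place: `ord_v(Δ_min) ≤ f_v + 8`.** At `v ∤ 2` with `j` integral the special
fibre has `m_v ≤ 9` components (Silverman ATAEC Table 4.1) and Ogg's formula `f_v = ord_v(Δ_min) + 1 − m_v`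
is the tree's definition of `f_v`. [folklore] -/
theorem ordMinimalDiscriminant_le_conductorExponent_add_eight (hp2 : natGenerator v ≠ 2)
    (hj : v.valuation ℚ W.j ≤ 1) : W.ordMinimalDiscriminant v ≤ W.conductorExponent v + 8 := by
  have hm9 := numComponentsAt_le_nine_of_valuation_j_le_one W v hp2 hj
  have hmle : W.numComponentsAt v ≤ W.ordMinimalDiscriminant v + 1 :=
    WeierstrassCurve.numComponentsAt_le_holds v W
  have hfdef : W.conductorExponent v = W.ordMinimalDiscriminant v + 1 - W.numComponentsAt v := rfl
  omega

/-- **Potentially good at `2`: `ord_2(Δ_min) ≤ 18`** (Tate's algorithm at `2`: type `Iₙ*` gives `≤ 18`,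
every other type has `m ≤ 9` components and `f_2 ≤ 8`, so `≤ 16`; Silverman ATAEC IV.9.4, IV.10.4;
Papadopoulos 1993, Table IV) — the explicit constant of the tree's `stub_potentiallyGoodOrdTwo`. [folklore] -/
theorem ordMinimalDiscriminant_le_eighteen_of_valuation_j_le_one (hv : natGenerator v = 2)
    (hj : v.valuation ℚ W.j ≤ 1) : W.ordMinimalDiscriminant v ≤ 18 := by
  have h16 : W.numComponentsAt v ≤ 9 → W.ordMinimalDiscriminant v ≤ 18 := fun hm =>
    (ordMinimalDiscriminant_le_sixteen_of_numComponentsAt_le_nine W v hm).trans (by norm_num)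
  rcases hk : W.kodairaSymbolAt v with n | _ | _ | _ | n | _ | _ | _
  · rcases n with _ | n
    · exact h16 (by unfold WeierstrassCurve.numComponentsAt; rw [hk]; simp [KodairaSymbol.numComponents])
    · -- `Iₙ`, `n ≥ 1`: multiplicative reduction, `|j|_v = exp(ord_v Δ_min) > 1`
      obtain ⟨hm, hord⟩ :=
        (WeierstrassCurve.kodairaSymbolAt_eq_I_iff_holds v W (Nat.succ_ne_zero n)).mp hk
      have h :=
        WeierstrassCurve.valuation_j_eq_exp_ordMinimalDiscriminant_of_hasMultiplicativeReductionAt v W hm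
      rw [h, ← WithZero.exp_zero, WithZero.exp_le_exp] at hj
      omega
  · exact h16 (by unfold WeierstrassCurve.numComponentsAt; rw [hk]; simp [KodairaSymbol.numComponents])
  · exact h16 (by unfold WeierstrassCurve.numComponentsAt; rw [hk]; simp [KodairaSymbol.numComponents])
  · exact h16 (by unfold WeierstrassCurve.numComponentsAt; rw [hk]; simp [KodairaSymbol.numComponents])
  · rcases n with _ | n
    · exact h16 (by unfold WeierstrassCurve.numComponentsAt; rw [hk]; simp [KodairaSymbol.numComponents])
    · exact ordMinimalDiscriminant_le_eighteen_of_kodairaSymbolAt_eq_Istar_succ W v hv hj hk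
  · exact h16 (by unfold WeierstrassCurve.numComponentsAt; rw [hk]; simp [KodairaSymbol.numComponents])
  · exact h16 (by unfold WeierstrassCurve.numComponentsAt; rw [hk]; simp [KodairaSymbol.numComponents])
  · exact h16 (by unfold WeierstrassCurve.numComponentsAt; rw [hk]; simp [KodairaSymbol.numComponents])

/-- **Potentially multiplicative, additive, odd place: `ord_v(Δ_min) ≤ ord_p den(j) + 6`.** For `v ∤ 2`
with `f_v ≠ 1` and `ord_v(j) < 0`, the twist `E ⊗ χ_{p*}` (`p* = ±p ≡ 1 mod 4`) is multiplicative at `v`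
with the same `j`, and `ord_v Δ_min(E) ≤ ord_v Δ_min(E ⊗ χ_{p*}) + 6` (Silverman ATAEC IV.9.4 Step 7,
Ex. 4.37; AEC VIII.8). [cite: SilvermanATAEC1994, IV.9.4 Step 7 and Ex. 4.37] -/
theorem ordMinimalDiscriminant_le_den_add_six (hp2 : natGenerator v ≠ 2)
    (hf : W.conductorExponent v ≠ 1) (hj : 1 < v.valuation ℚ W.j) :
    W.ordMinimalDiscriminant v ≤ (W.j).den.factorization (natGenerator v) + 6 := by
  have hpp : (natGenerator v).Prime := prime_natGenerator v
  obtain ⟨s, k, hs, hk⟩ := exists_sign_four_mul_add_one hpp hp2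
  have hkq : 4 * (k : ℚ) + 1 = (s : ℚ) * (natGenerator v : ℚ) := by exact_mod_cast hk
  have hsp0 : (s : ℚ) * (natGenerator v : ℚ) ≠ 0 :=
    mul_ne_zero (by rcases hs with rfl | rfl <;> simp) (by exact_mod_cast hpp.ne_zero)
  have hu0 : 4 * (k : ℚ) + 1 ≠ 0 := by rw [hkq]; exact hsp0
  haveI hW₁ : (W.twistModel (k : ℚ)).IsElliptic :=
    ⟨by rw [WeierstrassCurve.twistModel_Δ]; exact (IsUnit.mk0 _ (pow_ne_zero 6 hu0)).mul W.isUnit_Δ⟩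
  -- the twist is multiplicative at `v`, with the same `j`
  have hf₁ : (W.twistModel (k : ℚ)).conductorExponent v = 1 :=
    conductorExponent_twistModel_pstar_eq_one v hp2 W hf hj hs hk
  have hm₁ : (W.twistModel (k : ℚ)).HasMultiplicativeReductionAt v :=
    (WeierstrassCurve.conductorExponent_eq_one_iff_holds v _).mp hf₁
  have hj₁ : (W.twistModel (k : ℚ)).j = W.j := by
    obtain ⟨C, -, hC⟩ := W.exists_variableChange_twistModel_eq_quadraticTwist (k : ℚ)
    haveI : (W.quadraticTwist (4 * (k : ℚ) + 1)).IsElliptic := W.isElliptic_quadraticTwist hu0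
    calc (W.twistModel (k : ℚ)).j = (C • W.twistModel (k : ℚ)).j :=
          (WeierstrassCurve.variableChange_j (W.twistModel (k : ℚ)) C).symm
      _ = (W.quadraticTwist (4 * (k : ℚ) + 1)).j := j_eq_of_eq hC
      _ = W.j := WeierstrassCurve.j_quadraticTwist W hu0
  have hord : W.ordMinimalDiscriminant v ≤ (W.twistModel (k : ℚ)).ordMinimalDiscriminant v + 6 :=
    ordMinimalDiscriminant_le_twist_add_six v W hs hk
  have hden := ordMinimalDiscriminant_le_den_of_hasMultiplicativeReductionAt (W.twistModel (k : ℚ)) v hm₁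
  rw [hj₁] at hden
  omega

/-- **Potentially multiplicative, additive, at `2`: `ord_2(Δ_min) ≤ ord_2 den(j) + 3 f_2`.** With `ord_2(j) = −ν < 0`,
`f_2 ≠ 1`: `E ≅ T^{(d)}` (Tate normal form, `4 ∤ d`); `d ≡ 1 (4)` is multiplicative (excluded), `d ≡ 3 (4)` gives
`(f_2, ord_2 Δ_min) = (4, ν + 12)`, `d ≡ 2 (4)` gives `(6, ν + 18)` (Kraus 1989; Silverman ATAEC IV.9–11); `ν ≤ ord_2 den(j)`.
[folklore] -/
theorem ordMinimalDiscriminant_le_den_add_three_mul_two (hv : natGenerator v = 2)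
    (hf : W.conductorExponent v ≠ 1) (hj : 1 < v.valuation ℚ W.j) :
    W.ordMinimalDiscriminant v ≤ (W.j).den.factorization (natGenerator v) + 3 * W.conductorExponent v := by
  -- the place of `𝓞 ℚ` above `2`
  set v' : HeightOneSpectrum (𝓞 ℚ) := (primesEquiv (R := 𝓞 ℚ)).symm ⟨2, Nat.prime_two⟩ with hv'def
  have hv' : natGenerator v' = 2 :=
    congrArg Subtype.val ((primesEquiv (R := 𝓞 ℚ)).apply_symm_apply ⟨2, Nat.prime_two⟩)
  have hgen : natGenerator v = natGenerator v' := hv.trans hv'.symm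
  have hj' : 1 < v'.valuation ℚ W.j := (one_lt_valuation_iff_of_natGenerator_eq v v' hgen W.j).mp hj
  have hfvv' : W.conductorExponent v = W.conductorExponent v' :=
    WeierstrassCurve.conductorExponent_eq_of_primesEquiv_eq v v' W (Subtype.ext hgen)
  have hordvv' : W.ordMinimalDiscriminant v = W.ordMinimalDiscriminant v' :=
    ordMinimalDiscriminant_eq_of_natGenerator_eq W v v' hgen
  obtain ⟨hj0, hj1728, -⟩ := W.j_ne_and_valuation_j_sub_eq_of_one_lt_valuation_j v' hj'
  obtain ⟨ν, -, hν⟩ := WeierstrassCurve.exists_valuation_j_eq_exp v' W hj'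
  obtain ⟨d, -, hd4, C, hC⟩ := W.exists_int_variableChange_eq_quadraticTwist_tateFormOfJ hj0 hj1728
  -- `ν ≤ ord_2 den(j)`
  have hνden : (ν : ℤ) ≤ ((W.j).den.factorization (natGenerator v) : ℤ) := by
    rw [hgen]; exact le_factorization_den_of_valuation_ringOfIntegers_eq v' hν
  have hcases : d % 4 = 1 ∨ d % 4 = 3 ∨ d % 4 = 2 := by omega
  rcases hcases with h1 | h3 | h2
  · -- `d ≡ 1 (mod 4)`: multiplicative at `2`, excluded
    exfalso
    have hmult := WeierstrassCurve.hasMultiplicativeReductionAt_of_emod_four_eq_one v' hv' W hj' h1 hC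
    exact hf (hfvv'.trans ((WeierstrassCurve.conductorExponent_eq_one_iff_holds v' W).mpr hmult))
  · -- `d ≡ 3 (mod 4)`: `f₂ = 4`, `ord₂ Δ_min = ν + 12`
    have hf4 : W.conductorExponent v = 4 := hfvv'.trans
      (WeierstrassCurve.conductorExponent_eq_four_of_emod_four_eq_three v' hv' W hj' h3 hC).1
    have hord12 : W.ordMinimalDiscriminant v = ν + 12 := hordvv'.trans
      (WeierstrassCurve.kodairaSymbolAt_and_ordMinimalDiscriminant_of_emod_four_eq_three v' hv' W hj'
        hν h3 hC).2
    omega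
  · -- `d ≡ 2 (mod 4)`: `f₂ = 6`, `ord₂ Δ_min = ν + 18`
    have hf6 : W.conductorExponent v = 6 := hfvv'.trans
      (WeierstrassCurve.conductorExponent_eq_six_of_emod_four_eq_two v' hv' W hj' h2 hC).1
    have hord18 : W.ordMinimalDiscriminant v = ν + 18 := hordvv'.trans
      (WeierstrassCurve.kodairaSymbolAt_and_ordMinimalDiscriminant_of_emod_four_eq_two v' hv' W hj'
        hν h2 hC).2
    omega

/-- **The local inequality.** At every finite place `v` of `ℤ` over `p`:
`ord_v(Δ_min(E)) ≤ ord_p den(j_E) + 5 f_v + 8·[p = 2]` (good / multiplicative / additive potentially good: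
`v ∤ 2`: `≤ f_v + 8 ≤ 5 f_v`, `v ∣ 2`: `≤ 18` / additive potentially multiplicative: `v ∤ 2`: `+6`, `v ∣ 2`: `+3 f_v`). [folklore] -/
theorem localBound :
    W.ordMinimalDiscriminant v ≤ (W.j).den.factorization (natGenerator v) + 5 * W.conductorExponent v +
      (if natGenerator v = 2 then 8 else 0) := by
  by_cases h0 : W.ordMinimalDiscriminant v = 0
  · rw [h0]; exact Nat.zero_le _
  by_cases hm : W.HasMultiplicativeReductionAt v
  · have := ordMinimalDiscriminant_le_den_of_hasMultiplicativeReductionAt W v hm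
    omega
  have hf2 := two_le_conductorExponent_of_not_hasMultiplicativeReductionAt W v h0 hm
  have hf1 : W.conductorExponent v ≠ 1 := by omega
  by_cases hj : v.valuation ℚ W.j ≤ 1
  · by_cases hp2 : natGenerator v = 2
    · rw [if_pos hp2]
      have := ordMinimalDiscriminant_le_eighteen_of_valuation_j_le_one W v hp2 hj
      omega
    · rw [if_neg hp2]
      have := ordMinimalDiscriminant_le_conductorExponent_add_eight W v hp2 hj
      omega
  · rw [not_le] at hj
    by_cases hp2 : natGenerator v = 2
    · rw [if_pos hp2]
      have := ordMinimalDiscriminant_le_den_add_three_mul_two W v hp2 hf1 hj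
      omega
    · rw [if_neg hp2]
      have := ordMinimalDiscriminant_le_den_add_six W v hp2 hf1 hj
      omega

end DiscLeJHeight

open DiscLeJHeight

/-! ### Global statements -/

/-- **`|Δ_min(E)| ∣ 2⁸ · den(j_E) · N_E⁵`** for every elliptic curve `E/ℚ`: the minimal discriminant is the
denominator of `j` up to `∏_{p additive} p^{e_p}`, `e_p ≤ 5 f_p + 8·[p = 2]` (`DiscLeJHeight.localBound` summed).
Silverman AEC VII.5.1, VIII.8; ATAEC IV.9–IV.11. [folklore] -/
theorem minimalDiscriminantNorm_dvd_den_j_mul (W : WeierstrassCurve ℚ) [W.IsElliptic] :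
    W.minimalDiscriminantNorm ℤ ∣ 2 ^ 8 * (W.j).den * W.conductorNorm ℤ ^ 5 := by
  have hΔ0 : W.minimalDiscriminantNorm ℤ ≠ 0 := (WeierstrassCurve.minimalDiscriminantNorm_pos_holds W).ne'
  have hN0 : W.conductorNorm ℤ ≠ 0 := (WeierstrassCurve.conductorNorm_pos_holds W).ne'
  have hden0 : (W.j).den ≠ 0 := (W.j).den_pos.ne'
  have h28 : (2 ^ 8 : ℕ) ≠ 0 := by norm_num
  rw [← Nat.factorization_prime_le_iff_dvd hΔ0
    (mul_ne_zero (mul_ne_zero h28 hden0) (pow_ne_zero 5 hN0))]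
  intro p hp
  set v : HeightOneSpectrum ℤ := (primesEquiv (R := ℤ)).symm ⟨p, hp⟩ with hvdef
  have hv : natGenerator v = p :=
    congrArg Subtype.val ((primesEquiv (R := ℤ)).apply_symm_apply ⟨p, hp⟩)
  have hΔ : (W.minimalDiscriminantNorm ℤ).factorization p = W.ordMinimalDiscriminant v := by
    rw [← hv]; exact WeierstrassCurve.factorization_minimalDiscriminantNorm_holds W v
  have hN : (W.conductorNorm ℤ).factorization p = W.conductorExponent v := by
    rw [← hv]; exact WeierstrassCurve.factorization_conductorNorm_holds W v
  have h2 : (2 ^ 8 : ℕ).factorization p = if p = 2 then 8 else 0 := by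
    rw [Nat.factorization_pow, Finsupp.smul_apply, Nat.prime_two.factorization, Finsupp.single_apply]
    by_cases h : p = 2
    · subst h; simp
    · simp [h, Ne.symm h]
  rw [Nat.factorization_mul (mul_ne_zero h28 hden0) (pow_ne_zero 5 hN0), Nat.factorization_mul h28 hden0,
    Finsupp.add_apply, Finsupp.add_apply, h2, Nat.factorization_pow (W.conductorNorm ℤ) 5,
    Finsupp.smul_apply, smul_eq_mul, hΔ, hN]
  have := localBound W v
  rw [hv] at this
  omega

/-- **`log |Δ_min(E)| ≤ log den(j_E) + 5 log N_E + 8 log 2`** for every elliptic curve `E/ℚ`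
(logarithm of `minimalDiscriminantNorm_dvd_den_j_mul`). [folklore] -/
theorem log_minimalDiscriminantNorm_le_log_den_j (W : WeierstrassCurve ℚ) [W.IsElliptic] :
    Real.log (W.minimalDiscriminantNorm ℤ : ℝ) ≤
      Real.log ((W.j).den : ℝ) + 5 * Real.log (W.conductorNorm ℤ : ℝ) + 8 * Real.log 2 := by
  have hN0 : 0 < W.conductorNorm ℤ := WeierstrassCurve.conductorNorm_pos_holds W
  have hden0 : 0 < (W.j).den := (W.j).den_pos
  have hpos : 0 < 2 ^ 8 * (W.j).den * W.conductorNorm ℤ ^ 5 := by positivity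
  have hle : W.minimalDiscriminantNorm ℤ ≤ 2 ^ 8 * (W.j).den * W.conductorNorm ℤ ^ 5 :=
    Nat.le_of_dvd hpos (minimalDiscriminantNorm_dvd_den_j_mul W)
  have hΔpos : (0 : ℝ) < (W.minimalDiscriminantNorm ℤ : ℝ) := by
    exact_mod_cast WeierstrassCurve.minimalDiscriminantNorm_pos_holds W
  have hleR : (W.minimalDiscriminantNorm ℤ : ℝ) ≤
      (2 : ℝ) ^ 8 * ((W.j).den : ℝ) * (W.conductorNorm ℤ : ℝ) ^ 5 := by
    exact_mod_cast hle
  have hNR : (0 : ℝ) < (W.conductorNorm ℤ : ℝ) := by exact_mod_cast hN0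
  have hdenR : (0 : ℝ) < ((W.j).den : ℝ) := by exact_mod_cast hden0
  calc Real.log (W.minimalDiscriminantNorm ℤ : ℝ)
      ≤ Real.log ((2 : ℝ) ^ 8 * ((W.j).den : ℝ) * (W.conductorNorm ℤ : ℝ) ^ 5) :=
        Real.log_le_log hΔpos hleR
    _ = Real.log ((W.j).den : ℝ) + 5 * Real.log (W.conductorNorm ℤ : ℝ) + 8 * Real.log 2 := by
        rw [Real.log_mul (by positivity) (by positivity), Real.log_mul (by positivity) (by positivity),
          Real.log_pow, Real.log_pow]
        push_cast
        ring

/-- **DiscLeJHeight** in the route file's spelling of the naive height `h(j) = log max(|num j|, den j)`: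
`log |Δ_min(E)| ≤ h(j_E) + 5 log N_E + 8 log 2` for every `E/ℚ` (`a = 1`, `b = 5`, `d = 8 log 2`). [folklore] -/
theorem discLeJHeight (W : WeierstrassCurve ℚ) [W.IsElliptic] :
    Real.log (W.minimalDiscriminantNorm ℤ : ℝ) ≤
      Real.log (max (|((W.j).num : ℝ)|) ((W.j).den : ℝ)) + 5 * Real.log (W.conductorNorm ℤ : ℝ) +
        8 * Real.log 2 := by
  have hdenR : (0 : ℝ) < ((W.j).den : ℝ) := by exact_mod_cast (W.j).den_pos
  have hlog : Real.log ((W.j).den : ℝ) ≤ Real.log (max (|((W.j).num : ℝ)|) ((W.j).den : ℝ)) :=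
    Real.log_le_log hdenR (le_max_right _ _)
  linarith [log_minimalDiscriminantNorm_le_log_den_j W]

/-- **The level-1 composition with the dictionary half discharged** (per curve): if `h(j_E) ≤ c^{ω(N_E)} (K log N_E + B)`
with `c ≥ 1` then `log|Δ_min(E)| ≤ c^{ω(N_E)} ((K + 5) log N_E + (B + 8 log 2))` (`discLeJHeight` and `c^{ω} ≥ 1`); so
`JHeightPlaceBudget (c, K, B)` of the birth skeleton of stmt-ABC-25422 (OPEN, load-bearing, NOT attempted here) gives
`PlaceBudgetSzpiro (c, K + 5, B + 8 log 2)`. Glue, NOT progress on X1. [folklore] -/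
theorem log_minimalDiscriminantNorm_le_budget_of_jHeight_le {c K B : ℝ} (hc : 1 ≤ c)
    (W : WeierstrassCurve ℚ) [W.IsElliptic]
    (hW : Real.log (max (|((W.j).num : ℝ)|) ((W.j).den : ℝ)) ≤
      c ^ (W.conductorNorm ℤ).primeFactors.card * (K * Real.log (W.conductorNorm ℤ : ℝ) + B)) :
    Real.log (W.minimalDiscriminantNorm ℤ : ℝ) ≤
      c ^ (W.conductorNorm ℤ).primeFactors.card *
        ((K + 5) * Real.log (W.conductorNorm ℤ : ℝ) + (B + 8 * Real.log 2)) := by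
  have hlog2 : 0 ≤ Real.log 2 := Real.log_nonneg one_le_two
  have hN1 : (1 : ℝ) ≤ (W.conductorNorm ℤ : ℝ) := by
    exact_mod_cast WeierstrassCurve.conductorNorm_pos_holds W
  have hlogN : 0 ≤ Real.log (W.conductorNorm ℤ : ℝ) := Real.log_nonneg hN1
  have hcω : 1 ≤ c ^ (W.conductorNorm ℤ).primeFactors.card := one_le_pow₀ hc
  have h1 := discLeJHeight W
  have h3 : 5 * Real.log (W.conductorNorm ℤ : ℝ) + 8 * Real.log 2 ≤
      c ^ (W.conductorNorm ℤ).primeFactors.card *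
        (5 * Real.log (W.conductorNorm ℤ : ℝ) + 8 * Real.log 2) := by
    have h5 : 0 ≤ 5 * Real.log (W.conductorNorm ℤ : ℝ) + 8 * Real.log 2 := by positivity
    calc 5 * Real.log (W.conductorNorm ℤ : ℝ) + 8 * Real.log 2
        = 1 * (5 * Real.log (W.conductorNorm ℤ : ℝ) + 8 * Real.log 2) := (one_mul _).symm
      _ ≤ c ^ (W.conductorNorm ℤ).primeFactors.card *
          (5 * Real.log (W.conductorNorm ℤ : ℝ) + 8 * Real.log 2) := mul_le_mul_of_nonneg_right hcω h5
  calc Real.log (W.minimalDiscriminantNorm ℤ : ℝ)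
      ≤ Real.log (max (|((W.j).num : ℝ)|) ((W.j).den : ℝ)) + 5 * Real.log (W.conductorNorm ℤ : ℝ) +
          8 * Real.log 2 := h1
    _ ≤ c ^ (W.conductorNorm ℤ).primeFactors.card * (K * Real.log (W.conductorNorm ℤ : ℝ) + B) +
          c ^ (W.conductorNorm ℤ).primeFactors.card *
            (5 * Real.log (W.conductorNorm ℤ : ℝ) + 8 * Real.log 2) := by linarith
    _ = c ^ (W.conductorNorm ℤ).primeFactors.card *
          ((K + 5) * Real.log (W.conductorNorm ℤ : ℝ) + (B + 8 * Real.log 2)) := by ring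

end Summit.ABC.ABC.Theorems

end
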